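import Mathlib
import Literature.Analysis.Matrix.QuadraticCombesThomas

/-!
# IMS localisation with a quadratic partition of unity (support for stub `stub_windowModesLocalised`)
(line `block-away-the-sign`, crux `Summit.QuantumFields.QCD.Theses.SpectralDefectExtinction.ExtinctionBuildsQCD`,
item stmt-QuantumFields-18064)

Finite-dimensional linear algebra over `ℂ` (Mathlib plus Schur's test / Cauchy–Schwarz from
`Literature/Analysis/Matrix/QuadraticCombesThomas.lean`).  For a matrix `H` on a finite index set `ι` with
an `ℕ`-valued pseudo-distance `dist`, off-site (`dist ≠ 0`) absolute row and column sums `≤ h`, and a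
family `χ_a : ι → ℝ` with `Σ_a χ_a² = 1`, constant on `dist = 0` pairs joined by `H` and with
`Σ_a (χ_a(i) − χ_a(j))² ≤ D` on `dist ≠ 0` pairs joined by `H`:

* `ims_partition_floor` — the **IMS localisation inequality**: if every localised vector `χ_a v` obeys
  the floor `E² ‖χ_a v‖² ≤ ‖H(χ_a v)‖²`, then `E² ‖v‖² ≤ (1 + Dh/2) ‖Hv‖² + (Dh/2 + Dh²) ‖v‖²`
  (expand `H(χ_a v) = χ_a Hv + [H, χ_a] v`; the first-order cross terms cancel in the sum over `a` up to the
  double commutator `Σ_a χ_a(i)(χ_a(j) − χ_a(i)) = −½ Σ_a (χ_a(i) − χ_a(j))²`);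
* `sq_floor_shift` — from a floor `E₂² ‖v‖² ≤ ‖Hv‖²` to `(E₂ − E₀)² ‖v‖² ≤ ‖(H − λ)v‖²` for `|λ| ≤ E₀ ≤ E₂`;
* `countP_abs_re_lt_mono` — monotonicity of the window count in the window.

References (prose): Cycon–Froese–Kirsch–Simon, *Schrödinger operators* (1987) §3.1 (IMS localisation formula);
Agmon, *Lectures on exponential decay* (Princeton Math. Notes 29, 1982).
-/

noncomputable section

namespace Summit.QuantumFields.QCD.Cruxes.ExtinctionBuildsQCD.BlockAwayTheSign

open scoped BigOperators Classical Matrix ComplexConjugate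
open Matrix Finset

namespace WindowModes

section IMS

variable {ι 𝒜 : Type*} [Fintype ι] [Fintype 𝒜]

/-- `‖a + b‖² = ‖a‖² + 2 Re(a b̄) + ‖b‖²` in `ℂ`. -/
theorem norm_add_sq_complex (a b : ℂ) :
    ‖a + b‖ ^ 2 = ‖a‖ ^ 2 + 2 * (a * conj b).re + ‖b‖ ^ 2 := by
  rw [← Complex.normSq_eq_norm_sq, ← Complex.normSq_eq_norm_sq, ← Complex.normSq_eq_norm_sq,
    Complex.normSq_add]
  ring

/-- Schur-type bound for the bilinear form `Σ_{i,j} |u_i| |K_{ij}| |v_j| ≤ (h/2)(‖u‖² + ‖v‖²)` when the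
absolute row and column sums of `K` are at most `h`. -/
theorem sum_sum_norm_mul_le (K : Matrix ι ι ℂ) (h : ℝ)
    (hrow : ∀ i, ∑ j, ‖K i j‖ ≤ h) (hcol : ∀ j, ∑ i, ‖K i j‖ ≤ h) (u v : ι → ℂ) :
    ∑ i, ∑ j, ‖u i‖ * ‖K i j‖ * ‖v j‖ ≤ h / 2 * (∑ i, ‖u i‖ ^ 2 + ∑ j, ‖v j‖ ^ 2) := by
  have hpt : ∀ i j, ‖u i‖ * ‖K i j‖ * ‖v j‖ ≤
      ‖K i j‖ * ‖u i‖ ^ 2 / 2 + ‖K i j‖ * ‖v j‖ ^ 2 / 2 := by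
    intro i j
    have h1 : ‖u i‖ * ‖v j‖ ≤ (‖u i‖ ^ 2 + ‖v j‖ ^ 2) / 2 := by
      nlinarith [sq_nonneg (‖u i‖ - ‖v j‖)]
    have h2 := mul_le_mul_of_nonneg_left h1 (norm_nonneg (K i j))
    calc ‖u i‖ * ‖K i j‖ * ‖v j‖ = ‖K i j‖ * (‖u i‖ * ‖v j‖) := by ring
      _ ≤ ‖K i j‖ * ((‖u i‖ ^ 2 + ‖v j‖ ^ 2) / 2) := h2
      _ = _ := by ring
  have hA : ∑ i, ∑ j, ‖K i j‖ * ‖u i‖ ^ 2 / 2 ≤ h / 2 * ∑ i, ‖u i‖ ^ 2 := by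
    calc ∑ i, ∑ j, ‖K i j‖ * ‖u i‖ ^ 2 / 2 = ∑ i, (∑ j, ‖K i j‖) * (‖u i‖ ^ 2 / 2) := by
          refine Finset.sum_congr rfl fun i _ => ?_
          rw [Finset.sum_mul]
          exact Finset.sum_congr rfl fun j _ => by ring
      _ ≤ ∑ i, h * (‖u i‖ ^ 2 / 2) :=
          Finset.sum_le_sum fun i _ => mul_le_mul_of_nonneg_right (hrow i) (by positivity)
      _ = h / 2 * ∑ i, ‖u i‖ ^ 2 := by rw [← Finset.mul_sum, ← Finset.sum_div]; ring
  have hB : ∑ i, ∑ j, ‖K i j‖ * ‖v j‖ ^ 2 / 2 ≤ h / 2 * ∑ j, ‖v j‖ ^ 2 := by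
    rw [Finset.sum_comm]
    calc ∑ j, ∑ i, ‖K i j‖ * ‖v j‖ ^ 2 / 2 = ∑ j, (∑ i, ‖K i j‖) * (‖v j‖ ^ 2 / 2) := by
          refine Finset.sum_congr rfl fun j _ => ?_
          rw [Finset.sum_mul]
          exact Finset.sum_congr rfl fun i _ => by ring
      _ ≤ ∑ j, h * (‖v j‖ ^ 2 / 2) :=
          Finset.sum_le_sum fun j _ => mul_le_mul_of_nonneg_right (hcol j) (by positivity)
      _ = h / 2 * ∑ j, ‖v j‖ ^ 2 := by rw [← Finset.mul_sum, ← Finset.sum_div]; ring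
  calc ∑ i, ∑ j, ‖u i‖ * ‖K i j‖ * ‖v j‖
      ≤ ∑ i, ∑ j, (‖K i j‖ * ‖u i‖ ^ 2 / 2 + ‖K i j‖ * ‖v j‖ ^ 2 / 2) :=
        Finset.sum_le_sum fun i _ => Finset.sum_le_sum fun j _ => hpt i j
    _ = (∑ i, ∑ j, ‖K i j‖ * ‖u i‖ ^ 2 / 2) + ∑ i, ∑ j, ‖K i j‖ * ‖v j‖ ^ 2 / 2 := by
        rw [← Finset.sum_add_distrib]
        exact Finset.sum_congr rfl fun i _ => Finset.sum_add_distrib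
    _ ≤ h / 2 * ∑ i, ‖u i‖ ^ 2 + h / 2 * ∑ j, ‖v j‖ ^ 2 := add_le_add hA hB
    _ = _ := by ring

/-- The summed commutator bound: `Σ_a ‖[K, χ_a] v‖² ≤ D h² ‖v‖²` when `|K_{ij}| Σ_a (χ_a(j) − χ_a(i))² ≤ D |K_{ij}|`
and the absolute row and column sums of `K` are at most `h` (pointwise Cauchy–Schwarz, then the sums). -/
theorem sum_sum_norm_sq_comm_le (K : Matrix ι ι ℂ) (h : ℝ) (hh : 0 ≤ h)
    (hrow : ∀ i, ∑ j, ‖K i j‖ ≤ h) (hcol : ∀ j, ∑ i, ‖K i j‖ ≤ h)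
    (χ : 𝒜 → ι → ℝ) (D : ℝ) (hD : 0 ≤ D)
    (hΔ : ∀ i j, ‖K i j‖ * ∑ a, (χ a j - χ a i) ^ 2 ≤ D * ‖K i j‖) (v : ι → ℂ) :
    ∑ a, ∑ i, ‖∑ j, K i j * ((χ a j - χ a i : ℝ) : ℂ) * v j‖ ^ 2 ≤
      D * h ^ 2 * ∑ j, ‖v j‖ ^ 2 := by
  -- pointwise Cauchy–Schwarz
  have hcs : ∀ a i, ‖∑ j, K i j * ((χ a j - χ a i : ℝ) : ℂ) * v j‖ ^ 2 ≤
      (∑ j, ‖K i j‖ * (χ a j - χ a i) ^ 2) * ∑ j, ‖K i j‖ * ‖v j‖ ^ 2 := by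
    intro a i
    have h1 : ‖∑ j, K i j * ((χ a j - χ a i : ℝ) : ℂ) * v j‖ ≤
        ∑ j, ‖K i j‖ * |χ a j - χ a i| * ‖v j‖ := by
      refine (norm_sum_le _ _).trans (le_of_eq (Finset.sum_congr rfl fun j _ => ?_))
      rw [norm_mul, norm_mul, Complex.norm_real, Real.norm_eq_abs]
    calc _ ≤ (∑ j, ‖K i j‖ * |χ a j - χ a i| * ‖v j‖) ^ 2 := pow_le_pow_left₀ (norm_nonneg _) h1 2
      _ ≤ _ := Finset.sum_sq_le_sum_mul_sum_of_sq_le_mul _ (fun j _ => by positivity)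
          (fun j _ => by positivity)
          (fun j _ => le_of_eq (by rw [← sq_abs (χ a j - χ a i)]; ring))
  -- sum over `a`: the first factor sums to `Σ_j |K_{ij}| Δ_{ij} ≤ D h`
  have hfirst : ∀ i, ∑ a, ∑ j, ‖K i j‖ * (χ a j - χ a i) ^ 2 ≤ D * h := by
    intro i
    rw [Finset.sum_comm]
    calc ∑ j, ∑ a, ‖K i j‖ * (χ a j - χ a i) ^ 2 = ∑ j, ‖K i j‖ * ∑ a, (χ a j - χ a i) ^ 2 := by
          refine Finset.sum_congr rfl fun j _ => ?_; rw [Finset.mul_sum]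
      _ ≤ ∑ j, D * ‖K i j‖ := Finset.sum_le_sum fun j _ => hΔ i j
      _ = D * ∑ j, ‖K i j‖ := by rw [Finset.mul_sum]
      _ ≤ D * h := mul_le_mul_of_nonneg_left (hrow i) hD
  have hsecond : ∑ i, ∑ j, ‖K i j‖ * ‖v j‖ ^ 2 ≤ h * ∑ j, ‖v j‖ ^ 2 := by
    rw [Finset.sum_comm]
    calc ∑ j, ∑ i, ‖K i j‖ * ‖v j‖ ^ 2 = ∑ j, (∑ i, ‖K i j‖) * ‖v j‖ ^ 2 := by
          refine Finset.sum_congr rfl fun j _ => ?_; rw [Finset.sum_mul]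
      _ ≤ ∑ j, h * ‖v j‖ ^ 2 :=
          Finset.sum_le_sum fun j _ => mul_le_mul_of_nonneg_right (hcol j) (by positivity)
      _ = h * ∑ j, ‖v j‖ ^ 2 := by rw [Finset.mul_sum]
  calc ∑ a, ∑ i, ‖∑ j, K i j * ((χ a j - χ a i : ℝ) : ℂ) * v j‖ ^ 2
      ≤ ∑ a, ∑ i, (∑ j, ‖K i j‖ * (χ a j - χ a i) ^ 2) * ∑ j, ‖K i j‖ * ‖v j‖ ^ 2 :=
        Finset.sum_le_sum fun a _ => Finset.sum_le_sum fun i _ => hcs a i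
    _ = ∑ i, (∑ a, ∑ j, ‖K i j‖ * (χ a j - χ a i) ^ 2) * ∑ j, ‖K i j‖ * ‖v j‖ ^ 2 := by
        rw [Finset.sum_comm]
        exact Finset.sum_congr rfl fun i _ => by rw [Finset.sum_mul]
    _ ≤ ∑ i, (D * h) * ∑ j, ‖K i j‖ * ‖v j‖ ^ 2 :=
        Finset.sum_le_sum fun i _ => mul_le_mul_of_nonneg_right (hfirst i)
          (Finset.sum_nonneg fun j _ => by positivity)
    _ = D * h * ∑ i, ∑ j, ‖K i j‖ * ‖v j‖ ^ 2 := by rw [Finset.mul_sum]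
    _ ≤ D * h * (h * ∑ j, ‖v j‖ ^ 2) := mul_le_mul_of_nonneg_left hsecond (mul_nonneg hD hh)
    _ = D * h ^ 2 * ∑ j, ‖v j‖ ^ 2 := by ring

omit [Fintype ι] in
/-- The double-commutator identity behind IMS: if `Σ_a χ_a(i)² = 1 = Σ_a χ_a(j)²` then
`Σ_a χ_a(i)(χ_a(j) − χ_a(i)) = −½ Σ_a (χ_a(j) − χ_a(i))²`. -/
theorem sum_mul_sub_eq_neg_half (χ : 𝒜 → ι → ℝ) (hχ1 : ∀ i, ∑ a, χ a i ^ 2 = 1) (i j : ι) :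
    ∑ a, χ a i * (χ a j - χ a i) = -(1 / 2) * ∑ a, (χ a j - χ a i) ^ 2 := by
  have hi := hχ1 i
  have hj := hχ1 j
  have h1 : ∑ a, χ a i * (χ a j - χ a i) = ∑ a, χ a i * χ a j - ∑ a, χ a i ^ 2 := by
    rw [← Finset.sum_sub_distrib]; exact Finset.sum_congr rfl fun a _ => by ring
  have h2 : ∑ a, (χ a j - χ a i) ^ 2 = ∑ a, χ a j ^ 2 - 2 * ∑ a, χ a i * χ a j + ∑ a, χ a i ^ 2 := by
    rw [Finset.mul_sum, ← Finset.sum_sub_distrib, ← Finset.sum_add_distrib]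
    exact Finset.sum_congr rfl fun a _ => by ring
  rw [h1, h2, hi, hj]; ring

/-- **IMS localisation inequality for a quadratic partition of unity.**  Let `H` be a matrix on the finite
index set `ι`, `dist` an `ℕ`-valued pseudo-distance, the absolute row and column sums of `H` over
`{dist ≠ 0}` at most `h`, and `χ_a : ι → ℝ` (`a ∈ 𝒜`) with `Σ_a χ_a(i)² = 1`, `χ_a(i) = χ_a(j)` whenever
`H_{ij} ≠ 0` and `dist(i,j) = 0`, and `Σ_a (χ_a(i) − χ_a(j))² ≤ D` whenever `H_{ij} ≠ 0` and `dist(i,j) ≠ 0`.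
If every localised vector satisfies the floor `E² Σ_i |χ_a(i) v_i|² ≤ Σ_i |(H(χ_a v))_i|²`, then
`E² ‖v‖² ≤ (1 + Dh/2) ‖Hv‖² + (Dh/2 + Dh²) ‖v‖²`. -/
theorem ims_partition_floor (dist : ι → ι → ℕ) (H : Matrix ι ι ℂ) (h : ℝ) (hh : 0 ≤ h)
    (hrow : ∀ i, ∑ j ∈ univ.filter (fun j => dist i j ≠ 0), ‖H i j‖ ≤ h)
    (hcol : ∀ j, ∑ i ∈ univ.filter (fun i => dist i j ≠ 0), ‖H i j‖ ≤ h)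
    (χ : 𝒜 → ι → ℝ) (hχ1 : ∀ i, ∑ a, χ a i ^ 2 = 1)
    (hχ0 : ∀ a i j, H i j ≠ 0 → dist i j = 0 → χ a i = χ a j)
    (D : ℝ) (hD : 0 ≤ D) (hχD : ∀ i j, H i j ≠ 0 → dist i j ≠ 0 → ∑ a, (χ a i - χ a j) ^ 2 ≤ D)
    (E : ℝ) (v : ι → ℂ)
    (hv : ∀ a, E ^ 2 * ∑ i, ‖(χ a i : ℂ) * v i‖ ^ 2 ≤
      ∑ i, ‖(H *ᵥ fun j => (χ a j : ℂ) * v j) i‖ ^ 2) :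
    E ^ 2 * ∑ i, ‖v i‖ ^ 2 ≤
      (1 + D * h / 2) * ∑ i, ‖(H *ᵥ v) i‖ ^ 2 + (D * h / 2 + D * h ^ 2) * ∑ i, ‖v i‖ ^ 2 := by
  -- the off-site part `K` of `H`
  set K : Matrix ι ι ℂ := Matrix.of fun i j => if dist i j = 0 then 0 else H i j with hK
  have hKn : ∀ i j, ‖K i j‖ = if dist i j ≠ 0 then ‖H i j‖ else 0 := by
    intro i j; by_cases hd : dist i j = 0 <;> simp [hK, hd]
  have hrow' : ∀ i, ∑ j, ‖K i j‖ ≤ h := fun i => by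
    calc ∑ j, ‖K i j‖ = ∑ j ∈ univ.filter (fun j => dist i j ≠ 0), ‖H i j‖ := by
          rw [Finset.sum_filter]; exact Finset.sum_congr rfl fun j _ => hKn i j
      _ ≤ h := hrow i
  have hcol' : ∀ j, ∑ i, ‖K i j‖ ≤ h := fun j => by
    calc ∑ i, ‖K i j‖ = ∑ i ∈ univ.filter (fun i => dist i j ≠ 0), ‖H i j‖ := by
          rw [Finset.sum_filter]; exact Finset.sum_congr rfl fun i _ => hKn i j
      _ ≤ h := hcol j
  have hΔ : ∀ i j, ‖K i j‖ * ∑ a, (χ a j - χ a i) ^ 2 ≤ D * ‖K i j‖ := by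
    intro i j
    by_cases hd : dist i j = 0
    · simp [hK, hd]
    · by_cases hH0 : H i j = 0
      · simp [hK, hd, hH0]
      · have hn : ‖K i j‖ = ‖H i j‖ := by simp [hK, hd]
        have hs : ∑ a, (χ a j - χ a i) ^ 2 = ∑ a, (χ a i - χ a j) ^ 2 :=
          Finset.sum_congr rfl fun a _ => by ring
        rw [hn, hs, mul_comm]
        exact mul_le_mul_of_nonneg_right (hχD i j hH0 hd) (norm_nonneg _)
  -- `u = Hv`, the commutator vectors `w_a` and their χ-weighted sum `m`
  set u : ι → ℂ := H *ᵥ v with hu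
  set w : 𝒜 → ι → ℂ := fun a i => ∑ j, K i j * ((χ a j - χ a i : ℝ) : ℂ) * v j with hw
  set m : ι → ℂ := fun i => ∑ j, K i j * ((-(1 / 2) * ∑ a, (χ a j - χ a i) ^ 2 : ℝ) : ℂ) * v j
    with hm
  -- `H(χ_a v) = χ_a u + w_a`
  have hsplit : ∀ a i, (H *ᵥ fun j => (χ a j : ℂ) * v j) i = (χ a i : ℂ) * u i + w a i := by
    intro a i
    have hwH : w a i = ∑ j, H i j * ((χ a j - χ a i : ℝ) : ℂ) * v j := by
      simp only [hw]
      refine Finset.sum_congr rfl fun j _ => ?_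
      simp only [hK, Matrix.of_apply]
      split_ifs with hd
      · by_cases hH0 : H i j = 0
        · simp [hH0]
        · rw [hχ0 a i j hH0 hd]; simp
      · rfl
    rw [hwH]
    simp only [hu, Matrix.mulVec, dotProduct, Finset.mul_sum, ← Finset.sum_add_distrib]
    refine Finset.sum_congr rfl fun j _ => ?_
    push_cast
    ring
  -- `Σ_a χ_a(i) w_a(i) = m(i)`
  have hmsum : ∀ i, ∑ a, (χ a i : ℂ) * w a i = m i := by
    intro i
    have h1 : ∑ a, (χ a i : ℂ) * w a i =
        ∑ a, ∑ j, (χ a i : ℂ) * (K i j * ((χ a j - χ a i : ℝ) : ℂ) * v j) := by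
      refine Finset.sum_congr rfl fun a _ => ?_
      simp only [hw]
      rw [Finset.mul_sum]
    rw [h1, Finset.sum_comm]
    simp only [hm]
    refine Finset.sum_congr rfl fun j _ => ?_
    rw [← sum_mul_sub_eq_neg_half χ hχ1 i j]
    push_cast
    rw [Finset.mul_sum, Finset.sum_mul]
    exact Finset.sum_congr rfl fun a _ => by ring
  -- pointwise expansion of `‖χ_a u + w_a‖²`
  have hexp : ∀ a i, ‖(χ a i : ℂ) * u i + w a i‖ ^ 2 =
      χ a i ^ 2 * ‖u i‖ ^ 2 + 2 * (u i * conj ((χ a i : ℂ) * w a i)).re + ‖w a i‖ ^ 2 := by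
    intro a i
    rw [norm_add_sq_complex, norm_mul, mul_pow, Complex.norm_real, Real.norm_eq_abs, sq_abs]
    congr 2
    rw [map_mul, Complex.conj_ofReal]
    congr 1
    ring
  -- the sum over `a` and `i`
  have hsum : ∑ a, ∑ i, ‖(χ a i : ℂ) * u i + w a i‖ ^ 2 =
      ∑ i, ‖u i‖ ^ 2 + 2 * ∑ i, (u i * conj (m i)).re + ∑ a, ∑ i, ‖w a i‖ ^ 2 := by
    rw [Finset.sum_comm]
    have : ∀ i, ∑ a, ‖(χ a i : ℂ) * u i + w a i‖ ^ 2 =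
        ‖u i‖ ^ 2 + 2 * (u i * conj (m i)).re + ∑ a, ‖w a i‖ ^ 2 := by
      intro i
      simp only [hexp, Finset.sum_add_distrib]
      congr 1
      congr 1
      · rw [← Finset.sum_mul, hχ1 i, one_mul]
      · rw [← Finset.mul_sum, ← Complex.re_sum, ← Finset.mul_sum, ← hmsum i, map_sum]
    rw [Finset.sum_congr rfl fun i _ => this i, Finset.sum_add_distrib, Finset.sum_add_distrib,
      Finset.mul_sum, Finset.sum_comm]
  -- the cross term
  have hcross : 2 * ∑ i, (u i * conj (m i)).re ≤
      D * h / 2 * (∑ i, ‖u i‖ ^ 2 + ∑ j, ‖v j‖ ^ 2) := by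
    have hmi : ∀ i, ‖m i‖ ≤ D / 2 * ∑ j, ‖K i j‖ * ‖v j‖ := by
      intro i
      calc ‖m i‖ ≤ ∑ j, ‖K i j * ((-(1 / 2) * ∑ a, (χ a j - χ a i) ^ 2 : ℝ) : ℂ) * v j‖ :=
            norm_sum_le _ _
        _ = ∑ j, (1 / 2) * (‖K i j‖ * ∑ a, (χ a j - χ a i) ^ 2) * ‖v j‖ := by
            refine Finset.sum_congr rfl fun j _ => ?_
            rw [norm_mul, norm_mul, Complex.norm_real, Real.norm_eq_abs, abs_mul, abs_neg,
              abs_of_pos (by norm_num : (0 : ℝ) < 1 / 2),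
              abs_of_nonneg (Finset.sum_nonneg fun a _ => sq_nonneg (χ a j - χ a i))]
            ring
        _ ≤ ∑ j, (1 / 2) * (D * ‖K i j‖) * ‖v j‖ :=
            Finset.sum_le_sum fun j _ => mul_le_mul_of_nonneg_right
              (mul_le_mul_of_nonneg_left (hΔ i j) (by norm_num)) (norm_nonneg _)
        _ = D / 2 * ∑ j, ‖K i j‖ * ‖v j‖ := by
            rw [Finset.mul_sum]; exact Finset.sum_congr rfl fun j _ => by ring
    calc 2 * ∑ i, (u i * conj (m i)).re ≤ 2 * ∑ i, ‖u i‖ * (D / 2 * ∑ j, ‖K i j‖ * ‖v j‖) := by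
          refine mul_le_mul_of_nonneg_left (Finset.sum_le_sum fun i _ => ?_) (by norm_num)
          calc (u i * conj (m i)).re ≤ ‖u i * conj (m i)‖ := Complex.re_le_norm _
            _ = ‖u i‖ * ‖m i‖ := by rw [norm_mul, Complex.norm_conj]
            _ ≤ ‖u i‖ * (D / 2 * ∑ j, ‖K i j‖ * ‖v j‖) :=
                mul_le_mul_of_nonneg_left (hmi i) (norm_nonneg _)
      _ = D * ∑ i, ∑ j, ‖u i‖ * ‖K i j‖ * ‖v j‖ := by
          simp only [Finset.mul_sum]
          exact Finset.sum_congr rfl fun i _ => Finset.sum_congr rfl fun j _ => by ring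
      _ ≤ D * (h / 2 * (∑ i, ‖u i‖ ^ 2 + ∑ j, ‖v j‖ ^ 2)) :=
          mul_le_mul_of_nonneg_left (sum_sum_norm_mul_le K h hrow' hcol' u v) hD
      _ = _ := by ring
  -- the commutator term
  have hcomm : ∑ a, ∑ i, ‖w a i‖ ^ 2 ≤ D * h ^ 2 * ∑ j, ‖v j‖ ^ 2 :=
    sum_sum_norm_sq_comm_le K h hh hrow' hcol' χ D hD hΔ v
  -- the left-hand side: `E² ‖v‖² = Σ_a E² ‖χ_a v‖² ≤ Σ_a ‖H(χ_a v)‖²`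
  have hlhs : E ^ 2 * ∑ i, ‖v i‖ ^ 2 = ∑ a, E ^ 2 * ∑ i, ‖(χ a i : ℂ) * v i‖ ^ 2 := by
    rw [← Finset.mul_sum]
    congr 1
    rw [Finset.sum_comm]
    refine Finset.sum_congr rfl fun i _ => ?_
    have : ∀ a, ‖(χ a i : ℂ) * v i‖ ^ 2 = χ a i ^ 2 * ‖v i‖ ^ 2 := fun a => by
      rw [norm_mul, mul_pow, Complex.norm_real, Real.norm_eq_abs, sq_abs]
    simp only [this, ← Finset.sum_mul, hχ1 i, one_mul]
  calc E ^ 2 * ∑ i, ‖v i‖ ^ 2 = ∑ a, E ^ 2 * ∑ i, ‖(χ a i : ℂ) * v i‖ ^ 2 := hlhs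
    _ ≤ ∑ a, ∑ i, ‖(H *ᵥ fun j => (χ a j : ℂ) * v j) i‖ ^ 2 := Finset.sum_le_sum fun a _ => hv a
    _ = ∑ a, ∑ i, ‖(χ a i : ℂ) * u i + w a i‖ ^ 2 := by simp only [hsplit]
    _ = ∑ i, ‖u i‖ ^ 2 + 2 * ∑ i, (u i * conj (m i)).re + ∑ a, ∑ i, ‖w a i‖ ^ 2 := hsum
    _ ≤ ∑ i, ‖u i‖ ^ 2 + D * h / 2 * (∑ i, ‖u i‖ ^ 2 + ∑ j, ‖v j‖ ^ 2) +
          D * h ^ 2 * ∑ j, ‖v j‖ ^ 2 := by linarith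
    _ = _ := by ring

end IMS

/-! ## From a squared floor to the shifted floor -/

section Shift

variable {ι : Type*} [Fintype ι] [DecidableEq ι]

omit [DecidableEq ι] in
/-- `Σ ‖u_i − λ v_i‖² = Σ‖u_i‖² + λ² Σ‖v_i‖² − 2 λ Re⟨u, v⟩` for real `λ`. -/
theorem sum_norm_sq_sub_smul (u v : ι → ℂ) (lam : ℝ) :
    ∑ i, ‖u i - (lam : ℂ) * v i‖ ^ 2 =
      ∑ i, ‖u i‖ ^ 2 + lam ^ 2 * ∑ i, ‖v i‖ ^ 2 - 2 * lam * (star u ⬝ᵥ v).re := by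
  have hpt : ∀ i, ‖u i - (lam : ℂ) * v i‖ ^ 2 =
      ‖u i‖ ^ 2 + lam ^ 2 * ‖v i‖ ^ 2 - 2 * lam * (star (u i) * v i).re := by
    intro i
    rw [← Complex.normSq_eq_norm_sq, ← Complex.normSq_eq_norm_sq, ← Complex.normSq_eq_norm_sq,
      Complex.normSq_sub, Complex.normSq_mul, Complex.normSq_ofReal, map_mul, Complex.conj_ofReal]
    have : (u i * ((lam : ℂ) * conj (v i))).re = lam * (star (u i) * v i).re := by
      rw [show u i * ((lam : ℂ) * conj (v i)) = (lam : ℂ) * (u i * conj (v i)) by ring,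
        Complex.re_ofReal_mul]
      congr 1
      rw [Complex.star_def, ← Complex.conj_re (u i * conj (v i)), map_mul, Complex.conj_conj]
    rw [this]; ring
  simp only [hpt, Finset.sum_sub_distrib, Finset.sum_add_distrib, ← Finset.mul_sum, dotProduct,
    Complex.re_sum, Pi.star_apply]

/-- **Shifted floor from a squared floor.**  If `E₂² Σ‖v_i‖² ≤ Σ‖(Hv)_i‖²` with `E₀ ≤ E₂` then for every
real `λ` with `|λ| ≤ E₀`: `(E₂ − E₀)² Σ‖v_i‖² ≤ Σ‖((H − λ)v)_i‖²` (reverse triangle inequality in `ℓ²`). -/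
theorem sq_floor_shift (H : Matrix ι ι ℂ) (E₂ E₀ : ℝ) (hE : E₀ ≤ E₂) (v : ι → ℂ)
    (hv : E₂ ^ 2 * ∑ i, ‖v i‖ ^ 2 ≤ ∑ i, ‖(H *ᵥ v) i‖ ^ 2) (lam : ℝ) (hlam : |lam| ≤ E₀) :
    (E₂ - E₀) ^ 2 * ∑ i, ‖v i‖ ^ 2 ≤
      ∑ i, ‖((H - (lam : ℂ) • (1 : Matrix ι ι ℂ)) *ᵥ v) i‖ ^ 2 := by
  set u : ι → ℂ := H *ᵥ v with hu
  have hsub : ∀ i, ((H - (lam : ℂ) • (1 : Matrix ι ι ℂ)) *ᵥ v) i = u i - (lam : ℂ) * v i := by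
    intro i
    rw [Matrix.sub_mulVec, Pi.sub_apply, Matrix.smul_mulVec, Matrix.one_mulVec, Pi.smul_apply,
      smul_eq_mul]
  simp only [hsub]
  rw [sum_norm_sq_sub_smul u v lam]
  have hS0 : 0 ≤ ∑ i, ‖v i‖ ^ 2 := Finset.sum_nonneg fun i _ => by positivity
  have hT0 : 0 ≤ ∑ i, ‖u i‖ ^ 2 := Finset.sum_nonneg fun i _ => by positivity
  have hCS : |(star u ⬝ᵥ v).re| ≤ Real.sqrt (∑ i, ‖u i‖ ^ 2) * Real.sqrt (∑ i, ‖v i‖ ^ 2) :=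
    (Complex.abs_re_le_norm _).trans
      (Literature.Analysis.Matrix.norm_star_dotProduct_le_sqrt_mul_sqrt u v)
  have ha2 : Real.sqrt (∑ i, ‖u i‖ ^ 2) ^ 2 = ∑ i, ‖u i‖ ^ 2 := Real.sq_sqrt hT0
  have hb2 : Real.sqrt (∑ i, ‖v i‖ ^ 2) ^ 2 = ∑ i, ‖v i‖ ^ 2 := Real.sq_sqrt hS0
  set a := Real.sqrt (∑ i, ‖u i‖ ^ 2) with ha
  set b := Real.sqrt (∑ i, ‖v i‖ ^ 2) with hb
  have ha0 : 0 ≤ a := Real.sqrt_nonneg _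
  have hb0 : 0 ≤ b := Real.sqrt_nonneg _
  rw [← ha2, ← hb2] at hv ⊢
  have hab : E₂ * b ≤ a := by
    have h1 : (E₂ * b) ^ 2 ≤ a ^ 2 := by rw [mul_pow]; exact hv
    exact le_of_pow_le_pow_left₀ two_ne_zero ha0 h1
  have hP : lam * (star u ⬝ᵥ v).re ≤ |lam| * (a * b) := by
    calc lam * (star u ⬝ᵥ v).re ≤ |lam * (star u ⬝ᵥ v).re| := le_abs_self _
      _ = |lam| * |(star u ⬝ᵥ v).re| := abs_mul _ _
      _ ≤ |lam| * (a * b) := mul_le_mul_of_nonneg_left hCS (abs_nonneg _)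
  have hkey : (E₂ - E₀) * b ≤ a - |lam| * b := by
    nlinarith [mul_le_mul_of_nonneg_right hlam hb0]
  have hk0 : 0 ≤ (E₂ - E₀) * b := mul_nonneg (sub_nonneg.mpr hE) hb0
  calc (E₂ - E₀) ^ 2 * b ^ 2 = ((E₂ - E₀) * b) ^ 2 := by ring
    _ ≤ (a - |lam| * b) ^ 2 := pow_le_pow_left₀ hk0 hkey 2
    _ = a ^ 2 + |lam| ^ 2 * b ^ 2 - 2 * (|lam| * (a * b)) := by ring
    _ = a ^ 2 + lam ^ 2 * b ^ 2 - 2 * (|lam| * (a * b)) := by rw [sq_abs]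
    _ ≤ a ^ 2 + lam ^ 2 * b ^ 2 - 2 * (lam * (star u ⬝ᵥ v).re) := by linarith
    _ = a ^ 2 + lam ^ 2 * b ^ 2 - 2 * lam * (star u ⬝ᵥ v).re := by ring

end Shift

/-! ## Monotonicity of the window count -/

/-- The number of roots with `|Re z| < E` is monotone in `E`. -/
theorem countP_abs_re_lt_mono (s : Multiset ℂ) {E E' : ℝ} (h : E ≤ E') :
    s.countP (fun z => |z.re| < E) ≤ s.countP (fun z => |z.re| < E') := by
  rw [Multiset.countP_eq_card_filter, Multiset.countP_eq_card_filter]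
  exact Multiset.card_le_card (Multiset.monotone_filter_right s fun z hz => lt_of_lt_of_le hz h)

/-! ## Export -/

/-- **Helper W3-Aux (`stub_windowModesLocalisedAux`)**: the IMS partition-of-unity floor, the shifted floor and
the monotonicity of the window count, packaged as one registered statement. -/
theorem stub_windowModesLocalisedAux : (∀ {ι 𝒜 : Type} [Fintype ι] [Fintype 𝒜] (dist : ι → ι → ℕ) (H : Matrix ι ι ℂ) (h : ℝ), 0 ≤ h → (∀ i, ∑ j ∈ Finset.univ.filter (fun j => dist i j ≠ 0), ‖H i j‖ ≤ h) → (∀ j, ∑ i ∈ Finset.univ.filter (fun i => dist i j ≠ 0), ‖H i j‖ ≤ h) → ∀ (χ : 𝒜 → ι → ℝ), (∀ i, ∑ a, χ a i ^ 2 = 1) → (∀ a i j, H i j ≠ 0 → dist i j = 0 → χ a i = χ a j) → ∀ (D : ℝ), 0 ≤ D → (∀ i j, H i j ≠ 0 → dist i j ≠ 0 → ∑ a, (χ a i - χ a j) ^ 2 ≤ D) → ∀ (E : ℝ) (v : ι → ℂ), (∀ a, E ^ 2 * ∑ i, ‖(χ a i : ℂ) * v i‖ ^ 2 ≤ ∑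 i, ‖(H *ᵥ fun j => (χ a j : ℂ) * v j) i‖ ^ 2) → E ^ 2 * ∑ i, ‖v i‖ ^ 2 ≤ (1 + D * h / 2) * ∑ i, ‖(H *ᵥ v) i‖ ^ 2 + (D * h / 2 + D * h ^ 2) * ∑ i, ‖v i‖ ^ 2) ∧ (∀ {ι : Type} [Fintype ι] [DecidableEq ι] (H : Matrix ι ι ℂ) (E₂ E₀ : ℝ), E₀ ≤ E₂ → ∀ (v : ι → ℂ), E₂ ^ 2 * ∑ i, ‖v i‖ ^ 2 ≤ ∑ i, ‖(H *ᵥ v) i‖ ^ 2 → ∀ (lam : ℝ), |lam| ≤ E₀ → (E₂ - E₀) ^ 2 * ∑ i, ‖v i‖ ^ 2 ≤ ∑ i, ‖((H - (lam : ℂ) • (1 : Matrix ι ι ℂ)) *ᵥ v) i‖ ^ 2) ∧ (∀ (s : Multiset ℂ) (E E' : ℝ), E ≤ E' → s.countP (fun z => |z.re| < E) ≤ s.countP (fun z => |z.re| < E')) :=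
  ⟨fun dist H h hh hrow hcol χ hχ1 hχ0 D hD hχD E v hv =>
      ims_partition_floor dist H h hh hrow hcol χ hχ1 hχ0 D hD hχD E v hv,
    fun H E₂ E₀ hE v hv lam hlam => sq_floor_shift H E₂ E₀ hE v hv lam hlam,
    fun s _ _ h => countP_abs_re_lt_mono s h⟩

end WindowModes

end Summit.QuantumFields.QCD.Cruxes.ExtinctionBuildsQCD.BlockAwayTheSign

end
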